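import Literature.NumberTheory.NumberFields.ClassGroupNormGalois
import HarnessLib

/-!
# Norm relations in `ℤ[G]` (Biasse–Fieker–Hofmann–Page 2022): `d·M ⊆ ∑ᵢ aᵢ·M^{Hᵢ}` for every
# `G`-module, and the class-number bound `#Cl(L)[q] ≤ ∏ᵢ #Cl(L^{Hᵢ})[q]`, `v_p h(L) ≤ ∑ᵢ v_p h(L^{Hᵢ})`

Topic `NumberTheory/NumberFields`.  THEOREM-ONLY file (no definition, no named fact, no `sorry`), written
by the literature seat `bsd-potss-conjA-anchor` g10 (cell `bsd-potss`; supports stmt-BirchSwinnertonDyer-19386 /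
19413; closes nothing).  It formalises §2.1, Prop. 3.1 (2) and Prop. 3.7 of

* [BiasseEtAl2022] J.-F. Biasse, C. Fieker, T. Hofmann, A. Page, *Norm relations and computational problems
  in number fields*, J. London Math. Soc. 105 (2022) 2373–2414 (held text `paper:arxiv-2002.12332`, same
  numbering),

which is the published, CHARACTER-FREE form of the «fixed-vector descent» used on paper by the cell's
`p = 3, 5, 7` μ-censuses (memos `pub/bsd-potss/conjA-anchor/g9/FINDING-…-g9.md` §2, `…/g8/FINDING-…-g8.md` §1):
by [BiasseEtAl2022, Prop. 2.10] a norm relation with respect to a family `𝓗` of subgroups EXISTS iff every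
irreducible representation of `G` has a non-zero `H`-fixed vector for some `H ∈ 𝓗`, and by Prop. 2.18 one with
`p ∤ d` exists iff the same holds for the simple `𝔽_p[G]`-modules; the relation itself is then an explicit,
finitely checkable identity in `ℤ[G]` (found by linear algebra; cell table
`pub/bsd-potss/conjA-anchor/g10/`), and everything below follows from it with no representation theory.

## Statements formalised

Source, §3 eq. (⋆⋆) (Def. 2.1 cleared of denominators): a NORM RELATION of the finite group `G` with
respect to subgroups `H₁, …, H_ℓ` and DENOMINATOR `d ∈ ℤ_{>0}` is an identity
  `d = ∑ᵢ aᵢ · N_{Hᵢ} · bᵢ`  in `ℤ[G]`,  `aᵢ, bᵢ ∈ ℤ[G]`,  `N_H = ∑_{h ∈ H} h`.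
Here an element of `ℤ[G]` is its coefficient function `G → ℤ`, and the identity is stated coefficientwise:
the coefficient of `g` in `aᵢ N_{Hᵢ} bᵢ` is `∑_{x ∈ G} ∑_{h ∈ Hᵢ} aᵢ(x) bᵢ(h⁻¹x⁻¹g)`, that of `d = d·1_G` is
`d·[g = 1]` (hypothesis `hrel` below).  A `ℤ[G]`-module is a commutative group `M` with `ρ : G →* MulAut M`
(written multiplicatively, as Mathlib's `ClassGroup`); `f ∈ ℤ[G]` acts by `T_f(m) = ∏_g (ρ g m)^{f(g)}` and
`N_H` by `m ↦ ∏_{h ∈ H} ρ h m`.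

* §2.1 (bullet «for every `ℤ[G]`-module `M` and `x ∈ M`, we have `N_H x ∈ M^H`»):
  `apply_prod_apply_eq_of_mem`.
* **Prop. 3.1 (2)** «If `G` admits a norm relation of the form (⋆⋆), then the exponent of the quotient
  `M / ∑ᵢ aᵢ M^{Hᵢ}` is finite and divides `d`» — proof printed: `d·m = ∑ᵢ aᵢ N_{Hᵢ} bᵢ · m ∈ ∑ᵢ aᵢ M^{Hᵢ}`:
  `pow_eq_prod_of_normRelation` (the identity `m^d = ∏ᵢ T_{aᵢ}(N_{Hᵢ}(T_{bᵢ} m))`),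
  `exists_pow_eq_prod_fixed_of_normRelation` (the printed form, also inside a `G`-stable subgroup `N`), and
  the counting consequence `card_le_prod_card_fixed_of_normRelation`: a finite `G`-stable `N` of exponent
  prime to `d` has `#N ≤ ∏ᵢ #N^{Hᵢ}` (on such `N`, `m ↦ m^d` is onto).
* **Prop. 3.7** (class groups; `K/F` Galois with group `G`, `Φ : Cl(K) → ⊕ᵢ Cl(K^{Hᵢ})`,
  `[𝔞] ↦ (N_{K/K^{Hᵢ}}(𝔞^{bᵢ}))ᵢ`, `Ψ : ([𝔞ᵢ])ᵢ ↦ ∏ᵢ [𝔞ᵢ𝒪_K]^{aᵢ}`; printed proof: «the relation (⋆⋆) shows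
  that `Ψ ∘ Φ = d·Id`», whence «the group `Cl(K)/Cl(K)[d]` is isomorphic to a subgroup of
  `⊕ᵢ Cl(K^{Hᵢ})`»): `prod_extend_norm_eq_pow_of_normRelation` (`Ψ(Φ c) = c^d`, via the tree's Neukirch
  III (1.6)(iv) `classGroupExtend_classGroupNorm_eq_prod`), and its counting forms
  `card_torsion_classGroup_le_prod_of_normRelation` (`#Cl(K)[q] ≤ ∏ᵢ #Cl(K^{Hᵢ})[q]` for `gcd(q, d) = 1`:
  `Φ` is injective on `Cl(K)[q]`) and `padicValNat_card_classGroup_le_sum_of_normRelation`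
  (`v_p #Cl(K) ≤ ∑ᵢ v_p #Cl(K^{Hᵢ})` for `p ∤ d`; uses `#M[p^k] = p^{v_p #M}` for `k ≥ v_p #M`).

NOT formalised: Def. 2.15 (optimal denominator), Prop. 2.10 / 2.18 (existence criteria — representation
theory; only their OUTPUT, the identity, is consumed here), Thm. 1.1 / 2.11 (classification), the
`⊗ ℤ[1/d]` direct-summand clause of Prop. 3.7, §§3.1–3.2, §4 (algorithms).

Use (cell `bsd-potss`): along the cyclotomic `ℤ_p`-towers `K_n/F_n` of `K = ℚ(E[p])` with `p ∤ d`, the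
last theorem is the per-layer input `e_n(K) ≤ ∑ᵢ e_n(K^{Hᵢ})` of the μ-descent; the growth-form consequences
live in `Literature/NumberTheory/IwasawaTheory/ClassicalMuVanishesDescent.lean`.
-/

noncomputable section

open scoped NumberField

namespace Literature.NumberTheory.NumberFields.NormRelation

/-! ### §1 Norm relations acting on a `ℤ[G]`-module ([BiasseEtAl2022] §2.1, Prop. 3.1 (2)) -/

section Module

variable {G : Type*} [Group G] [Fintype G] [DecidableEq G] {M : Type*} [CommGroup M]

/-- `∏ᵢ a^{fᵢ} = a^{∑ᵢ fᵢ}` for integer exponents in a commutative group. [folklore] -/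
private theorem prod_zpow_eq_zpow_sum {α : Type*} (s : Finset α) (f : α → ℤ) (a : M) :
    ∏ i ∈ s, a ^ f i = a ^ ∑ i ∈ s, f i :=
  Finset.cons_induction (by simp) (fun i s hi ih => by rw [Finset.prod_cons, Finset.sum_cons, ih, zpow_add])
    s

omit [DecidableEq G] in
/-- `x · T_f(m) = ∏_g (g·m)^{f(x⁻¹ g)}` (the action of `x·f ∈ ℤ[G]`). [folklore] -/
private theorem apply_prod_zpow_eq (ρ : G →* MulAut M) (f : G → ℤ) (x : G) (m : M) :
    ρ x (∏ g, ρ g m ^ f g) = ∏ g, ρ g m ^ f (x⁻¹ * g) := by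
  rw [map_prod]
  have e1 : ∀ g, ρ x (ρ g m ^ f g) = ρ (x * g) m ^ f g := fun g => by
    rw [map_zpow, map_mul, MulAut.mul_apply]
  simp_rw [e1]
  exact Fintype.prod_equiv (Equiv.mulLeft x) _ _ fun g => by
    simp only [Equiv.coe_mulLeft, inv_mul_cancel_left]

omit [DecidableEq G] in
/-- `N_H(T_f m) = ∏_g (g·m)^{∑_{h ∈ H} f(h⁻¹ g)}` (the action of `N_H · f ∈ ℤ[G]`). [folklore] -/
private theorem prod_apply_prod_zpow_eq (ρ : G →* MulAut M) (H : Subgroup G) [Fintype H] (f : G → ℤ)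
    (m : M) : ∏ h : H, ρ (h : G) (∏ g, ρ g m ^ f g) = ∏ g, ρ g m ^ ∑ h : H, f ((h : G)⁻¹ * g) := by
  simp_rw [apply_prod_zpow_eq]
  rw [Finset.prod_comm]
  exact Finset.prod_congr rfl fun g _ => prod_zpow_eq_zpow_sum _ _ _

omit [DecidableEq G] in
/-- `T_a(N_H(T_b m)) = ∏_g (g·m)^{c(g)}` with `c(g) = ∑_x ∑_{h∈H} a(x) b(h⁻¹x⁻¹g)` the coefficient of `g` in
`a · N_H · b ∈ ℤ[G]`. [folklore] -/
private theorem prod_zpow_norm_prod_zpow_eq (ρ : G →* MulAut M) (H : Subgroup G) [Fintype H]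
    (a b : G → ℤ) (m : M) :
    ∏ x, ρ x (∏ h : H, ρ (h : G) (∏ g, ρ g m ^ b g)) ^ a x =
      ∏ g, ρ g m ^ ∑ x, ∑ h : H, a x * b ((h : G)⁻¹ * x⁻¹ * g) := by
  simp_rw [prod_apply_prod_zpow_eq, apply_prod_zpow_eq, ← Finset.prod_zpow, ← zpow_mul]
  rw [Finset.prod_comm]
  refine Finset.prod_congr rfl fun g _ => ?_
  rw [prod_zpow_eq_zpow_sum]
  refine congrArg _ (Finset.sum_congr rfl fun x _ => ?_)
  rw [mul_comm, Finset.mul_sum]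
  exact Finset.sum_congr rfl fun h _ => by rw [mul_assoc]

omit [Fintype G] [DecidableEq G] in
/-- [BiasseEtAl2022] §2.1: «For every `ℤ[G]`-module `M` and `x ∈ M`, we have `N_H x ∈ M^H`» — the norm
`N_H(x) = ∏_{h ∈ H} h·x` is fixed by `H`. [cite: BiasseEtAl2022, §2.1 (properties of the norm element)] -/
theorem apply_prod_apply_eq_of_mem (ρ : G →* MulAut M) (H : Subgroup G) [Fintype H] (x : M) {h : G}
    (hh : h ∈ H) : ρ h (∏ h' : H, ρ (h' : G) x) = ∏ h' : H, ρ (h' : G) x := by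
  rw [map_prod]
  have e1 : ∀ h' : H, ρ h (ρ (h' : G) x) = ρ (((⟨h, hh⟩ : H) * h' : H) : G) x := fun h' => by
    rw [Subgroup.coe_mul, map_mul, MulAut.mul_apply]
  simp_rw [e1]
  exact Fintype.prod_equiv (Equiv.mulLeft (⟨h, hh⟩ : H)) _ _ fun h' => rfl

/-- **[BiasseEtAl2022] Prop. 3.1 (2), the identity.**  A norm relation `d = ∑ᵢ aᵢ N_{Hᵢ} bᵢ` in `ℤ[G]`
(§3 eq. (⋆⋆), stated coefficientwise as `hrel`) acts on every `ℤ[G]`-module: for all `m`,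
`m^d = ∏ᵢ T_{aᵢ}(N_{Hᵢ}(T_{bᵢ} m))`  (printed: «`d·m = (∑ᵢ aᵢ N_{Hᵢ} bᵢ)·m = ∑ᵢ (aᵢ N_{Hᵢ} bᵢ·m)`»).
[cite: BiasseEtAl2022, Prop. 3.1 (2) (proof), §3 eq. (⋆⋆)] -/
theorem pow_eq_prod_of_normRelation (ρ : G →* MulAut M) {ι : Type*} [Fintype ι] (H : ι → Subgroup G)
    [∀ i, Fintype (H i)] (a b : ι → G → ℤ) (d : ℕ)
    (hrel : ∀ g : G, (∑ i, ∑ x : G, ∑ h : H i, a i x * b i ((h : G)⁻¹ * x⁻¹ * g)) =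
      if g = 1 then (d : ℤ) else 0)
    (m : M) :
    m ^ d = ∏ i, ∏ x, ρ x (∏ h : H i, ρ (h : G) (∏ g, ρ g m ^ b i g)) ^ a i x := by
  simp_rw [prod_zpow_norm_prod_zpow_eq]
  rw [Finset.prod_comm]
  simp_rw [prod_zpow_eq_zpow_sum, hrel]
  rw [Fintype.prod_eq_single 1 fun g hg => by rw [if_neg hg, zpow_zero]]
  rw [if_pos rfl, zpow_natCast, map_one, MulAut.one_apply]

/-- **[BiasseEtAl2022] Prop. 3.1 (2)** «If `G` admits a norm relation of the form (⋆⋆), then the exponent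
of the quotient `M / ∑ᵢ aᵢ M^{Hᵢ}` is finite and divides `d`»: every `m^d` is a product `∏ᵢ T_{aᵢ}(xᵢ)` of
twists of `Hᵢ`-FIXED elements `xᵢ` (`xᵢ = N_{Hᵢ}(T_{bᵢ} m)`); stated inside any `G`-stable subgroup `N ∋ m`
(then `xᵢ ∈ N`). [cite: BiasseEtAl2022, Prop. 3.1 (2)] -/
theorem exists_pow_eq_prod_fixed_of_normRelation (ρ : G →* MulAut M) (N : Subgroup M)
    (hN : ∀ g, ∀ m ∈ N, ρ g m ∈ N) {ι : Type*} [Fintype ι] (H : ι → Subgroup G) [∀ i, Fintype (H i)]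
    (a b : ι → G → ℤ) (d : ℕ)
    (hrel : ∀ g : G, (∑ i, ∑ x : G, ∑ h : H i, a i x * b i ((h : G)⁻¹ * x⁻¹ * g)) =
      if g = 1 then (d : ℤ) else 0)
    {m : M} (hm : m ∈ N) :
    ∃ x : ι → M, (∀ i, x i ∈ N) ∧ (∀ i, ∀ h ∈ H i, ρ h (x i) = x i) ∧
      m ^ d = ∏ i, ∏ g, ρ g (x i) ^ a i g := by
  refine ⟨fun i => ∏ h : H i, ρ (h : G) (∏ g, ρ g m ^ b i g), fun i => ?_,
    fun i h hh => apply_prod_apply_eq_of_mem ρ (H i) _ hh, pow_eq_prod_of_normRelation ρ H a b d hrel m⟩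
  exact Subgroup.prod_mem N fun h _ => hN _ _ (Subgroup.prod_mem N fun g _ => N.zpow_mem (hN g m hm) _)

/-- **Counting form of [BiasseEtAl2022] Prop. 3.1 (2)**: for a norm relation with denominator `d` and a finite
`G`-stable subgroup `N` of exponent `q` prime to `d` (so `m ↦ m^d` is onto `N`), `#N ≤ ∏ᵢ #N^{Hᵢ}` — the map
`(xᵢ)ᵢ ↦ ∏ᵢ T_{aᵢ}(xᵢ)` from `∏ᵢ N^{Hᵢ}` hits every `d`-th power. [cite: BiasseEtAl2022, Prop. 3.1 (2)] -/
theorem card_le_prod_card_fixed_of_normRelation [Finite M] (ρ : G →* MulAut M) (N : Subgroup M)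
    (hN : ∀ g, ∀ m ∈ N, ρ g m ∈ N) {q : ℕ} (hq : ∀ m ∈ N, m ^ q = 1) {ι : Type*} [Fintype ι]
    (H : ι → Subgroup G) [∀ i, Fintype (H i)] (a b : ι → G → ℤ) {d : ℕ} (hdq : Nat.Coprime d q)
    (hrel : ∀ g : G, (∑ i, ∑ x : G, ∑ h : H i, a i x * b i ((h : G)⁻¹ * x⁻¹ * g)) =
      if g = 1 then (d : ℤ) else 0) :
    Nat.card N ≤ ∏ i, Nat.card {m : M // m ∈ N ∧ ∀ h ∈ H i, ρ h m = m} := by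
  classical
  let Φ : (∀ i, {m : M // m ∈ N ∧ ∀ h ∈ H i, ρ h m = m}) → N := fun x =>
    ⟨∏ i, ∏ g, ρ g (x i : M) ^ a i g,
      Subgroup.prod_mem N fun i _ => Subgroup.prod_mem N fun g _ => N.zpow_mem (hN g _ (x i).2.1) _⟩
  -- Bezout: `m = (m^u)^d` on `N`
  have hbez : (d : ℤ) * Nat.gcdA d q + (q : ℤ) * Nat.gcdB d q = 1 := by
    rw [← Nat.gcd_eq_gcd_ab d q, Nat.Coprime.gcd_eq_one hdq]; rfl
  have hroot : ∀ m ∈ N, (m ^ Nat.gcdA d q) ^ d = m := by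
    intro m hm
    rw [← zpow_natCast, ← zpow_mul, mul_comm]
    calc m ^ ((d : ℤ) * Nat.gcdA d q) = m ^ ((d : ℤ) * Nat.gcdA d q) * m ^ ((q : ℤ) * Nat.gcdB d q) := by
          rw [zpow_mul m q, zpow_natCast, hq m hm, one_zpow, mul_one]
      _ = m := by rw [← zpow_add, hbez, zpow_one]
  have hΦ : Function.Surjective Φ := by
    rintro ⟨m, hm⟩
    obtain ⟨x, hxN, hxfix, hxm⟩ :=
      exists_pow_eq_prod_fixed_of_normRelation ρ N hN H a b d hrel (N.zpow_mem hm (Nat.gcdA d q))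
    refine ⟨fun i => ⟨x i, hxN i, hxfix i⟩, Subtype.ext ?_⟩
    change ∏ i, ∏ g, ρ g (x i) ^ a i g = m
    rw [← hxm, hroot m hm]
  haveI : ∀ i, Finite {m : M // m ∈ N ∧ ∀ h ∈ H i, ρ h m = m} := fun i =>
    Finite.of_injective (fun x => (x : M)) Subtype.val_injective
  calc Nat.card N ≤ Nat.card (∀ i, {m : M // m ∈ N ∧ ∀ h ∈ H i, ρ h m = m}) :=
        Nat.card_le_card_of_surjective Φ hΦ
    _ = ∏ i, Nat.card {m : M // m ∈ N ∧ ∀ h ∈ H i, ρ h m = m} := Nat.card_pi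

omit [Fintype G] [DecidableEq G] in
/-- `#M[p^k] = p^{v_p #M}` for `k ≥ v_p #M` (`M` a finite commutative group): the `p^k`-torsion is a
`p`-group containing a Sylow `p`-subgroup, whose exponent divides its order `p^{v_p #M}`. [folklore] -/
private theorem card_torsion_eq_pow_factorization [Finite M] {p : ℕ} [hp : Fact p.Prime] {k : ℕ}
    (hk : (Nat.card M).factorization p ≤ k) :
    Nat.card {m : M // m ^ p ^ k = 1} = p ^ (Nat.card M).factorization p := by
  classical
  obtain ⟨P⟩ : Nonempty (Sylow p M) := inferInstance
  have hP : Nat.card P = p ^ (Nat.card M).factorization p := P.card_eq_multiplicity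
  let T : Subgroup M := (powMonoidHom (p ^ k) : M →* M).ker
  have hT : ∀ m, m ∈ T ↔ m ^ p ^ k = 1 := fun m => Iff.rfl
  have hcardT : Nat.card {m : M // m ^ p ^ k = 1} = Nat.card T :=
    Nat.card_congr (Equiv.subtypeEquivRight fun m => (hT m).symm)
  have hPT : (P : Subgroup M) ≤ T := by
    intro x hx
    rw [hT, ← orderOf_dvd_iff_pow_eq_one]
    exact (Subgroup.orderOf_dvd_natCard (P : Subgroup M) hx).trans (hP ▸ pow_dvd_pow p hk)
  have hTp : IsPGroup p T := fun x => ⟨k, Subtype.ext ((hT x.1).mp x.2)⟩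
  obtain ⟨n, hn⟩ := IsPGroup.iff_card.mp hTp
  have hdvd : p ^ n ∣ Nat.card M := hn ▸ Subgroup.card_subgroup_dvd_card T
  have hn_le : n ≤ (Nat.card M).factorization p :=
    (hp.out.pow_dvd_iff_le_factorization Nat.card_pos.ne').mp hdvd
  have hle : Nat.card P ≤ Nat.card T := Subgroup.card_le_of_le hPT
  rw [hP, hn] at hle
  have hge : (Nat.card M).factorization p ≤ n := (Nat.pow_le_pow_iff_right hp.out.one_lt).mp hle
  rw [hcardT, hn, le_antisymm hn_le hge]

end Module

/-! ### §2 Class groups ([BiasseEtAl2022] Prop. 3.7) -/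

section ClassGroup

open NumberField

variable (F L : Type) [Field F] [NumberField F] [Field L] [NumberField L] [Algebra F L] [IsGalois F L]

/-- `i_{L/L^H}(N_{L/L^H} c) = ∏_{h ∈ H} h • c` — Neukirch III (1.6)(iv) (tree theorem
`classGroupExtend_classGroupNorm_eq_prod`) with `Gal(L/L^H)` re-indexed by `H`
(`IntermediateField.fixingSubgroup_fixedField`). [cite: NeukirchANT1999, Ch. III §1 Prop. (1.6) (iv)] -/
theorem classGroupExtend_classGroupNorm_fixedField_eq_prod (H : Subgroup (L ≃ₐ[F] L)) [Fintype H]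
    (c : ClassGroup (𝓞 L)) :
    classGroupExtend (IntermediateField.fixedField H) L (classGroupNorm (IntermediateField.fixedField H) L c) =
      ∏ h : H, ClassGroup.mulEquiv (AmbiguousClass.intAut (h : L ≃ₐ[F] L)) c := by
  classical
  set E := IntermediateField.fixedField H with hE
  rw [classGroupExtend_classGroupNorm_eq_prod E L c]
  -- `Gal(L/E) ≃ H`
  have hres : ∀ σ : L ≃ₐ[E] L, σ.restrictScalars F ∈ H := by
    intro σ
    rw [← IntermediateField.fixingSubgroup_fixedField H]
    intro x
    exact σ.commutes x
  have hfix : ∀ h : H, ∀ x : E, (h : L ≃ₐ[F] L) x = x := by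
    intro h x
    have hx : (x : L) ∈ IntermediateField.fixedField H := x.2
    exact hx ⟨h, h.2⟩
  let e : (L ≃ₐ[E] L) ≃ H :=
    { toFun := fun σ => ⟨σ.restrictScalars F, hres σ⟩
      invFun := fun h => { (h : L ≃ₐ[F] L) with commutes' := hfix h }
      left_inv := fun σ => by ext; rfl
      right_inv := fun h => by ext; rfl }
  exact Fintype.prod_equiv e _ _ fun σ => rfl

/-- **[BiasseEtAl2022] Prop. 3.7, the identity `Ψ ∘ Φ = d·Id`.**  `L/F` Galois with group `G`, a norm relation
`d = ∑ᵢ aᵢ N_{Hᵢ} bᵢ` in `ℤ[G]`; with `Φᵢ(c) = N_{L/L^{Hᵢ}}(bᵢ·c) ∈ Cl(L^{Hᵢ})` and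
`Ψ((eᵢ)ᵢ) = ∏ᵢ aᵢ · i_{L/L^{Hᵢ}}(eᵢ)`: `Ψ(Φ(c)) = c^d` for every class `c` of `L` (printed: «The relation (⋆⋆) shows
that `Ψ∘Φ : [𝔞] ↦ ∏ᵢ [𝔞]^{aᵢ N_{Hᵢ} bᵢ} = [𝔞]^d`»).  Here `f · c = ∏_g (g•c)^{f(g)}` for `f ∈ ℤ[G]`, the action
being `[I] ↦ [σ I]`. [cite: BiasseEtAl2022, Prop. 3.7 (proof)] [cite: NeukirchANT1999, Ch. III §1 Prop. (1.6) (iv)] -/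
theorem prod_extend_norm_eq_pow_of_normRelation [Fintype (L ≃ₐ[F] L)] [DecidableEq (L ≃ₐ[F] L)]
    {ι : Type*} [Fintype ι] (H : ι → Subgroup (L ≃ₐ[F] L)) [∀ i, Fintype (H i)]
    (a b : ι → (L ≃ₐ[F] L) → ℤ) (d : ℕ)
    (hrel : ∀ g : L ≃ₐ[F] L,
      (∑ i, ∑ x : L ≃ₐ[F] L, ∑ h : H i, a i x * b i ((h : L ≃ₐ[F] L)⁻¹ * x⁻¹ * g)) =
        if g = 1 then (d : ℤ) else 0)
    (c : ClassGroup (𝓞 L)) :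
    ∏ i, ∏ x : L ≃ₐ[F] L, ClassGroup.mulEquiv (AmbiguousClass.intAut x)
        (classGroupExtend (IntermediateField.fixedField (H i)) L
          (classGroupNorm (IntermediateField.fixedField (H i)) L
            (∏ g : L ≃ₐ[F] L, ClassGroup.mulEquiv (AmbiguousClass.intAut g) c ^ b i g))) ^ a i x =
      c ^ d := by
  let ρ : (L ≃ₐ[F] L) →* MulAut (ClassGroup (𝓞 L)) :=
    { toFun := fun σ => ClassGroup.mulEquiv (AmbiguousClass.intAut σ)
      map_one' := AmbiguousClass.mulEquiv_intAut_one
      map_mul' := fun σ τ => AmbiguousClass.mulEquiv_intAut_mul σ τ }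
  have hρ : ∀ σ c, ρ σ c = ClassGroup.mulEquiv (AmbiguousClass.intAut σ) c := fun _ _ => rfl
  simp_rw [classGroupExtend_classGroupNorm_fixedField_eq_prod, ← hρ]
  exact (pow_eq_prod_of_normRelation ρ H a b d hrel c).symm

/-- **[BiasseEtAl2022] Prop. 3.7, counting form** («the group `Cl(K)/Cl(K)[d]` is isomorphic to a subgroup of
`⊕ᵢ Cl(K^{Hᵢ})`»): for a norm relation with denominator `d` and any `q` prime to `d`, `Φ` is injective on
`Cl(L)[q]` with values in `∏ᵢ Cl(L^{Hᵢ})[q]`, so `#{c ∈ Cl(L) : c^q = 1} ≤ ∏ᵢ #{e ∈ Cl(L^{Hᵢ}) : e^q = 1}`.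
No hypothesis on `[L : L^{Hᵢ}]` is needed. [cite: BiasseEtAl2022, Prop. 3.7] -/
theorem card_torsion_classGroup_le_prod_of_normRelation [Fintype (L ≃ₐ[F] L)] [DecidableEq (L ≃ₐ[F] L)]
    {ι : Type*} [Fintype ι] (H : ι → Subgroup (L ≃ₐ[F] L)) [∀ i, Fintype (H i)]
    (a b : ι → (L ≃ₐ[F] L) → ℤ) {d q : ℕ} (hdq : Nat.Coprime d q)
    (hrel : ∀ g : L ≃ₐ[F] L,
      (∑ i, ∑ x : L ≃ₐ[F] L, ∑ h : H i, a i x * b i ((h : L ≃ₐ[F] L)⁻¹ * x⁻¹ * g)) =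
        if g = 1 then (d : ℤ) else 0) :
    Nat.card {c : ClassGroup (𝓞 L) // c ^ q = 1} ≤
      ∏ i, Nat.card {e : ClassGroup (𝓞 (IntermediateField.fixedField (H i))) // e ^ q = 1} := by
  classical
  -- `Φ` on `q`-torsion
  let T : ((L ≃ₐ[F] L) → ℤ) → ClassGroup (𝓞 L) →* ClassGroup (𝓞 L) := fun f =>
    MonoidHom.mk' (fun c => ∏ g : L ≃ₐ[F] L, ClassGroup.mulEquiv (AmbiguousClass.intAut g) c ^ f g)
      fun c c' => by simp only [map_mul, mul_zpow, Finset.prod_mul_distrib]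
  have hT : ∀ f c, T f c = ∏ g : L ≃ₐ[F] L, ClassGroup.mulEquiv (AmbiguousClass.intAut g) c ^ f g :=
    fun _ _ => rfl
  let Φi : ∀ i, ClassGroup (𝓞 L) →* ClassGroup (𝓞 (IntermediateField.fixedField (H i))) := fun i =>
    (classGroupNorm (IntermediateField.fixedField (H i)) L).comp (T (b i))
  let Φ : {c : ClassGroup (𝓞 L) // c ^ q = 1} →
      ∀ i, {e : ClassGroup (𝓞 (IntermediateField.fixedField (H i))) // e ^ q = 1} :=
    fun c i => ⟨Φi i c.1, by rw [← map_pow, c.2, map_one]⟩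
  -- `Ψ (Φ c) = c ^ d`, so `Φ c = Φ c'` forces `(c / c') ^ d = 1`
  have key : ∀ c : ClassGroup (𝓞 L),
      ∏ i, ∏ x : L ≃ₐ[F] L, ClassGroup.mulEquiv (AmbiguousClass.intAut x)
        (classGroupExtend (IntermediateField.fixedField (H i)) L (Φi i c)) ^ a i x = c ^ d :=
    fun c => prod_extend_norm_eq_pow_of_normRelation F L H a b d hrel c
  have hbez : (d : ℤ) * Nat.gcdA d q + (q : ℤ) * Nat.gcdB d q = 1 := by
    rw [← Nat.gcd_eq_gcd_ab d q, Nat.Coprime.gcd_eq_one hdq]; rfl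
  have hΦ : Function.Injective Φ := by
    rintro ⟨c, hc⟩ ⟨c', hc'⟩ h
    apply Subtype.ext
    have hi : ∀ i, Φi i c = Φi i c' := fun i => by
      have := congr_fun h i
      exact congrArg Subtype.val this
    have hd : (c / c') ^ d = 1 := by
      rw [div_pow, ← key c, ← key c', div_eq_one]
      exact Finset.prod_congr rfl fun i _ => by rw [hi i]
    have hq' : (c / c') ^ q = 1 := by rw [div_pow, hc, hc', div_one]
    have h1 : c / c' = 1 := by
      calc c / c' = (c / c') ^ ((d : ℤ) * Nat.gcdA d q + (q : ℤ) * Nat.gcdB d q) := by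
            rw [hbez, zpow_one]
        _ = 1 := by
            rw [zpow_add, zpow_mul, zpow_mul, zpow_natCast, zpow_natCast, hd, hq', one_zpow, one_zpow,
              mul_one]
    exact div_eq_one.mp h1
  haveI : ∀ i, Finite {e : ClassGroup (𝓞 (IntermediateField.fixedField (H i))) // e ^ q = 1} :=
    fun i => inferInstance
  calc Nat.card {c : ClassGroup (𝓞 L) // c ^ q = 1}
        ≤ Nat.card (∀ i, {e : ClassGroup (𝓞 (IntermediateField.fixedField (H i))) // e ^ q = 1}) :=
        Nat.card_le_card_of_injective Φ hΦ
    _ = ∏ i, Nat.card {e : ClassGroup (𝓞 (IntermediateField.fixedField (H i))) // e ^ q = 1} :=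
        Nat.card_pi

/-- **[BiasseEtAl2022] Prop. 3.7, `p`-adic counting form**: `L/F` Galois with group `G`, a norm relation
`d = ∑ᵢ aᵢ N_{Hᵢ} bᵢ` with `p ∤ d`; then `v_p #Cl(L) ≤ ∑ᵢ v_p #Cl(L^{Hᵢ})`
(`card_torsion_classGroup_le_prod_of_normRelation` at `q = p^k`, `k` above all the valuations, and
`#Cl[p^k] = p^{v_p #Cl}`).  Applied to the layers `L_n/F_n` of cyclotomic `ℤ_p`-towers this is the per-layer
input `e_n(L) ≤ ∑ᵢ e_n(L^{Hᵢ})` of the μ-descent. [cite: BiasseEtAl2022, Prop. 3.7] -/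
theorem padicValNat_card_classGroup_le_sum_of_normRelation [Fintype (L ≃ₐ[F] L)]
    [DecidableEq (L ≃ₐ[F] L)] {p : ℕ} [hp : Fact p.Prime] {ι : Type*} [Fintype ι]
    (H : ι → Subgroup (L ≃ₐ[F] L)) [∀ i, Fintype (H i)] (a b : ι → (L ≃ₐ[F] L) → ℤ) {d : ℕ}
    (hpd : ¬ p ∣ d)
    (hrel : ∀ g : L ≃ₐ[F] L,
      (∑ i, ∑ x : L ≃ₐ[F] L, ∑ h : H i, a i x * b i ((h : L ≃ₐ[F] L)⁻¹ * x⁻¹ * g)) =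
        if g = 1 then (d : ℤ) else 0) :
    padicValNat p (Nat.card (ClassGroup (𝓞 L))) ≤
      ∑ i, padicValNat p (Nat.card (ClassGroup (𝓞 (IntermediateField.fixedField (H i))))) := by
  classical
  set vL := (Nat.card (ClassGroup (𝓞 L))).factorization p with hvL
  set v : ι → ℕ := fun i => (Nat.card (ClassGroup (𝓞 (IntermediateField.fixedField (H i))))).factorization p
    with hv
  set k := vL + ∑ i, v i with hk
  have hkL : vL ≤ k := Nat.le_add_right _ _
  have hki : ∀ i, v i ≤ k := fun i =>
    (Finset.single_le_sum (fun j _ => Nat.zero_le (v j)) (Finset.mem_univ i)).trans (Nat.le_add_left _ _)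
  have hdq : Nat.Coprime d (p ^ k) :=
    Nat.Coprime.pow_right k ((Nat.Prime.coprime_iff_not_dvd hp.out).mpr hpd).symm
  have main := card_torsion_classGroup_le_prod_of_normRelation F L H a b hdq hrel
  rw [card_torsion_eq_pow_factorization hkL] at main
  have e2 : ∀ i, Nat.card {e : ClassGroup (𝓞 (IntermediateField.fixedField (H i))) // e ^ p ^ k = 1} =
      p ^ v i := fun i => card_torsion_eq_pow_factorization (hki i)
  simp_rw [e2, Finset.prod_pow_eq_pow_sum] at main
  rw [← Nat.factorization_def _ hp.out]
  simp_rw [← Nat.factorization_def _ hp.out]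
  exact (Nat.pow_le_pow_iff_right hp.out.one_lt).mp main

end ClassGroup

/-! ### §3 Transport of a norm relation along a group isomorphism

A relation is computed for a concrete model of the image (a matrix group `G ⊂ GL₂(𝔽_p)`, cell table
`pub/bsd-potss/conjA-anchor/g10/cert/`) and consumed for `Gal(L/F)`; this section moves the coefficientwise
identity `hrel` across `e : G ≃* G'` (subgroups `Hᵢ ↦ e(Hᵢ)`, coefficients `a ↦ a ∘ e⁻¹`, `b ↦ b ∘ e⁻¹`). -/

section Transport

variable {G G' : Type*} [Group G] [Fintype G] [DecidableEq G] [Group G'] [Fintype G'] [DecidableEq G']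

/-- **A norm relation transported along `e : G ≃* G'` is a norm relation** ([BiasseEtAl2022] Def. 2.1 is
isomorphism-invariant): if `d = ∑ᵢ aᵢ N_{Hᵢ} bᵢ` in `ℤ[G]` (coefficientwise, `hrel`), then
`d = ∑ᵢ (aᵢ∘e⁻¹) N_{e(Hᵢ)} (bᵢ∘e⁻¹)` in `ℤ[G']`. [cite: BiasseEtAl2022, Def. 2.1] -/
theorem normRelation_map_mulEquiv (e : G ≃* G') {ι : Type*} [Fintype ι] (H : ι → Subgroup G)
    [∀ i, Fintype (H i)] [∀ i, Fintype ((H i).map (e : G →* G'))] (a b : ι → G → ℤ) (d : ℕ)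
    (hrel : ∀ g : G, (∑ i, ∑ x : G, ∑ h : H i, a i x * b i ((h : G)⁻¹ * x⁻¹ * g)) =
      if g = 1 then (d : ℤ) else 0)
    (g' : G') :
    (∑ i, ∑ x' : G', ∑ h' : (H i).map (e : G →* G'),
        a i (e.symm x') * b i (e.symm ((h' : G')⁻¹ * x'⁻¹ * g'))) =
      if g' = 1 then (d : ℤ) else 0 := by
  have hg : (if g' = 1 then (d : ℤ) else 0) = if e.symm g' = 1 then (d : ℤ) else 0 := by
    simp only [MulEquiv.map_eq_one_iff]
  rw [hg, ← hrel (e.symm g')]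
  refine Finset.sum_congr rfl fun i _ => ?_
  -- reindex `x' = e x`
  refine (Fintype.sum_equiv e.toEquiv _ _ fun x => ?_).symm
  -- reindex `h' = e h`
  refine Fintype.sum_equiv (e.subgroupMap (H i)).toEquiv _ _ fun h => ?_
  have hx : e.symm (e.toEquiv x) = x := e.symm_apply_apply x
  have hh : ((e.subgroupMap (H i)).toEquiv h : G') = e (h : G) := rfl
  simp only [hh]
  rw [show e.toEquiv x = e x from rfl, e.symm_apply_apply]
  congr 1
  rw [← map_inv, ← map_inv, ← map_mul, ← e.apply_symm_apply g', ← map_mul, e.symm_apply_apply,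
    e.symm_apply_apply]

end Transport

end Literature.NumberTheory.NumberFields.NormRelation
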